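import Summits.Ventures.AbcSig.Levels.N2776S1
import Summits.Ventures.AbcSig.Levels.N2776S2

/-!
# Venture AbcSig — GENERATED level file, level 2776 (AGGREGATOR of 2 part files)

HONEST FRAMING. As in the part files `N2776S<i>.lean` (same generator run, same certified level file
`N2776.engine1.json`, sha256 `40e616173d5a2d67995be0a41359fe776e34d462945402af85994f379ae0c559`): this file only concatenates the orbit lists and the part summaries into
`level2776Orbits`, `level2776_wellformed`, `level2776_sieve` (the shapes the row templates consume). The split exists because the
tree's files are ≤ 400 lines. Union of residual exponents ≥ 7: [7, 17]; orbits not eliminable by the sieve: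
none. No Diophantine statement is made here; no claim on ABC or any summit.
-/

namespace Summit.Ventures.AbcSig

/-- All newform orbits of level 2776 (concatenation of the parts, engine order). -/
def level2776Orbits : List OrbitData :=
  level2776OrbitsS1 ++ level2776OrbitsS2

/-- Every listed entry is at an odd prime not dividing 2776. -/
theorem level2776_wellformed :
    ∀ o ∈ level2776Orbits, ∀ e ∈ o.coeffs, e.ell.Prime ∧ e.ell ≠ 2 ∧ ¬ e.ell ∣ 2776 := by
  unfold level2776Orbits
  exact List.forall_mem_append.2 ⟨level2776_wellformedS1, level2776_wellformedS2⟩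

/-- **Level 2776 summary.** For a prime exponent `n ≥ 7`, every orbit of level 2776 is sieve-eliminated by the
kernel certificates of the part files, except that the row's predicate `X` is assumed for: orbit_2776_3 if n ∈ [7], orbit_2776_4 if n ∈ [7, 17], orbit_2776_6 if n ∈ [7]. -/
theorem level2776_sieve (n : ℕ) (hn : n.Prime) (hmin : 7 ≤ n) (X : OrbitData → Prop)
    (h_orbit_2776_3 : n ∈ ([7] : List ℕ) → X orbit_2776_3)
    (h_orbit_2776_4 : n ∈ ([7, 17] : List ℕ) → X orbit_2776_4)
    (h_orbit_2776_6 : n ∈ ([7] : List ℕ) → X orbit_2776_6) :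
    ∀ o ∈ level2776Orbits, (∀ e ∈ o.coeffs, e.ell.Prime ∧ e.ell ≠ 2 ∧ ¬ e.ell ∣ 2776) ∧ (o.Eliminated bs04Allowed n ∨ X o) := by
  unfold level2776Orbits
  exact List.forall_mem_append.2 ⟨(level2776_sieveS1 n hn hmin X h_orbit_2776_3 h_orbit_2776_4), (level2776_sieveS2 n hn hmin X h_orbit_2776_6)⟩

end Summit.Ventures.AbcSig
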